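import Literature.AlgebraicGeometry.HodgeTheory.ProjectiveDegreePositiveInteger
import Literature.AlgebraicGeometry.HodgeTheory.ProjectiveSubquotientCohomologicalHilbertPolynomials
import Literature.AlgebraicGeometry.HodgeTheory.ProjectiveSubquotientHilbertFunction
import HarnessLib

/-!
# The degree of a subquotient sheaf is a positive integer; `dim Z ≤ dim X` for `Z ⊆ X`

Hartshorne, *Algebraic Geometry*, I §7: for a closed `Y ⊆ ℙ^r` with Hilbert polynomial `P_Y ≠ 0`
the degree `(deg P_Y)! · lc(P_Y)` is a positive integer (Prop. 7.6 (a)), `deg P_Y = dim Y`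
(Thm. 7.5), and the proof of Prop. 7.6 (b) compares Hilbert polynomials along
`0 → S/(I₁ ∩ I₂) → S/I₁ ⊕ S/I₂ → S/(I₁ + I₂) → 0`: leading coefficients of Hilbert polynomials are
positive, so degrees do not cancel in sums.

`ProjectiveDegreePositiveInteger` proves Prop. 7.6 (a) for graded QUOTIENTS `M = F_e ⧸ K`. This file:

* `leadingCoeff_hilbertPolynomial_subquot_pos`,
  `exists_pos_int_eq_factorial_mul_leadingCoeff_hilbertPolynomial_subquot` — **Prop. 7.6 (a) for
  graded SUBQUOTIENTS `N' ⧸ N`** (ideal sheaves `𝓘_{Z ⊂ X}`), via the quotient presentation of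
  `LaurentCechSubquotientPresentation`;
* **`natDegree_hilbertPolynomial_quot_mono`** — for graded `N ≤ N' ⊆ F_e`, i.e. closed subschemes
  `Z = (F_e ⧸ N')~ ⊆ X = (F_e ⧸ N)~`: **`deg P_Z ≤ deg P_X`** (`dim Z ≤ dim X`), and
  **`natDegree_hilbertPolynomial_subquot_le_quot`** — `deg P_{𝓘} ≤ deg P_X` for the ideal sheaf
  `𝓘 = (N' ⧸ N)~` (from `P_X = P_𝓘 + P_Z`, `hilbertPolynomial_subquot_eq_sub`, and positivity of the
  three leading coefficients);
* `leadingCoeff_hilbertPolynomial_quot_mono` — if moreover `deg P_Z = deg P_X` then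
  `lc(P_Z) ≤ lc(P_X)` (`deg Z ≤ deg X` for equidimensional `Z ⊆ X`).

## References

* [Hartshorne1977] R. Hartshorne, *Algebraic Geometry*, GTM 52, Springer 1977, I Thm. 7.5 (p. 51),
  I Prop. 7.6 (a), (b) (p. 52), III Ex. 5.1–5.2 (p. 230).
-/

noncomputable section

open CategoryTheory CategoryTheory.Limits Polynomial
open scoped Nat

universe u

namespace Literature.Algebra.Homology

namespace LaurentCech

open OrderedCech TopCohomology Literature.Algebra.Polynomial.IntegerValuedPolynomials

/-! ### Leading coefficients do not cancel -/

/-- `deg p ≤ deg (p + q)` when `p, q` are zero or have positive leading coefficients. [folklore] -/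
private theorem natDegree_le_natDegree_add {p q : ℚ[X]} (hp : p = 0 ∨ 0 < p.leadingCoeff)
    (hq : q = 0 ∨ 0 < q.leadingCoeff) : p.natDegree ≤ (p + q).natDegree := by
  rcases hp with rfl | hp
  · rw [natDegree_zero]; exact Nat.zero_le _
  rcases hq with rfl | hq
  · rw [add_zero]
  rcases lt_trichotomy p.natDegree q.natDegree with hlt | heq | hgt
  · rw [natDegree_add_eq_right_of_natDegree_lt hlt]; exact hlt.le
  · have hne : p.leadingCoeff + q.leadingCoeff ≠ 0 := (add_pos hp hq).ne'
    have hp0 : p ≠ 0 := fun h => by rw [h, leadingCoeff_zero] at hp; exact lt_irrefl _ hp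
    have hq0 : q ≠ 0 := fun h => by rw [h, leadingCoeff_zero] at hq; exact lt_irrefl _ hq
    have hdeg : (p + q).degree = p.degree := by
      rw [degree_add_eq_of_leadingCoeff_add_ne_zero hne, max_eq_left]
      rw [degree_eq_natDegree hp0, degree_eq_natDegree hq0, heq]
    rw [natDegree_eq_of_degree_eq hdeg]
  · rw [natDegree_add_eq_left_of_natDegree_lt hgt]

/-- `lc q ≤ lc (p + q)` when `p` is zero or has positive leading coefficient and
`deg q = deg (p + q)`. [folklore] -/
private theorem leadingCoeff_le_leadingCoeff_add {p q : ℚ[X]} (hp : p = 0 ∨ 0 < p.leadingCoeff)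
    (hq : q = 0 ∨ 0 < q.leadingCoeff) (hdeg : q.natDegree = (p + q).natDegree) :
    q.leadingCoeff ≤ (p + q).leadingCoeff := by
  rcases hp with rfl | hp
  · rw [zero_add]
  rcases hq with rfl | hq
  · rw [leadingCoeff_zero, add_zero]; exact hp.le
  have hp0 : p ≠ 0 := fun h => by rw [h, leadingCoeff_zero] at hp; exact lt_irrefl _ hp
  have hq0 : q ≠ 0 := fun h => by rw [h, leadingCoeff_zero] at hq; exact lt_irrefl _ hq
  rcases lt_or_ge p.natDegree q.natDegree with hlt | hge
  · rw [leadingCoeff_add_of_degree_lt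
      (by rw [degree_eq_natDegree hp0, degree_eq_natDegree hq0]; exact_mod_cast hlt)]
  · -- `deg p ≥ deg q = deg (p + q) ≥ deg p`, so all three degrees agree
    have hpq : p.natDegree ≤ (p + q).natDegree :=
      natDegree_le_natDegree_add (Or.inr hp) (Or.inr hq)
    have heq : p.natDegree = q.natDegree := le_antisymm (by omega) hge
    have hdeg' : p.degree = q.degree := by
      rw [degree_eq_natDegree hp0, degree_eq_natDegree hq0, heq]
    rw [leadingCoeff_add_of_degree_eq hdeg' (add_pos hp hq).ne']
    exact le_add_of_nonneg_left hp.le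

variable {k : Type u} [Field k] {r : ℕ} {J : Type} [Fintype J] (e : J → ℤ)

/-! ### Prop. 7.6 (a) for subquotients -/

omit [Fintype J] in
/-- `(deg Q)!·lc(Q) ∈ ℤ` for the `χ`-polynomial `Q` of a subquotient `N' ⧸ N` (its values at
integers are the integers `χ(Č_n(N' ⧸ N))`). [cite: Hartshorne1977, I Prop. 7.3 (a) (p. 49)]
[cite: Hartshorne1977, I Prop. 7.6 (a) (proof, p. 52)] -/
theorem exists_int_eq_factorial_mul_leadingCoeff_hilbertPolynomial_subquot
    {N N' : Submodule (P k r) (J → P k r)} (h : N ≤ N') {Q : ℚ[X]}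
    (hQ : ∀ n : ℤ, ((∑ q ∈ Finset.range (r + 1), (-1 : ℤ) ^ q *
      (Module.finrank k ((subquot e N N' h n).homology q) : ℤ) : ℤ) : ℚ) = Q.eval (n : ℚ)) :
    ∃ c : ℤ, ((Q.natDegree)! : ℚ) * Q.leadingCoeff = c :=
  exists_int_eq_factorial_mul_leadingCoeff Q 0 fun n _ => ⟨_, (hQ n).symm⟩

/-- **`lc(P_{N'⧸N}) > 0`** for a graded subquotient `N' ⧸ N ⊆ F_e ⧸ N` with `P_{N'⧸N} ≠ 0` (`k` a
field, `r ≥ 1`): positivity for its quotient presentation `F_{e'} ⧸ φ⁻¹N`.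
[cite: Hartshorne1977, I Prop. 7.6 (a) (proof, p. 52)] [cite: Hartshorne1977, I Thm. 7.5 (p. 51)] -/
theorem leadingCoeff_hilbertPolynomial_subquot_pos (hr : 1 ≤ r) {N N' : Submodule (P k r) (J → P k r)}
    (hN : IsGraded e N) (hN' : IsGraded e N') (h : N ≤ N') {Q : ℚ[X]}
    (hQ : ∀ n : ℤ, ((∑ q ∈ Finset.range (r + 1), (-1 : ℤ) ^ q *
      (Module.finrank k ((subquot e N N' h n).homology q) : ℤ) : ℤ) : ℚ) = Q.eval (n : ℚ))
    (hQ0 : Q ≠ 0) : 0 < Q.leadingCoeff := by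
  obtain ⟨n', e', K', hK', hfin, -⟩ := exists_quot_finrank_homology_eq_subquot hN hN' h
  exact leadingCoeff_hilbertPolynomial_pos e' hr hK' (eulerChar_eq_of_finrank_homology_eq e hfin hQ) hQ0

/-- **Hartshorne I Prop. 7.6 (a) for `(N' ⧸ N)~`**: if `P_{N'⧸N} ≠ 0`, the degree
`(deg P)!·lc(P)` of the subquotient sheaf is a positive integer.
[cite: Hartshorne1977, I Prop. 7.6 (a) (p. 52)] -/
theorem exists_pos_int_eq_factorial_mul_leadingCoeff_hilbertPolynomial_subquot (hr : 1 ≤ r)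
    {N N' : Submodule (P k r) (J → P k r)} (hN : IsGraded e N) (hN' : IsGraded e N') (h : N ≤ N')
    {Q : ℚ[X]}
    (hQ : ∀ n : ℤ, ((∑ q ∈ Finset.range (r + 1), (-1 : ℤ) ^ q *
      (Module.finrank k ((subquot e N N' h n).homology q) : ℤ) : ℤ) : ℚ) = Q.eval (n : ℚ))
    (hQ0 : Q ≠ 0) : ∃ c : ℤ, 0 < c ∧ ((Q.natDegree)! : ℚ) * Q.leadingCoeff = c := by
  obtain ⟨c, hc⟩ := exists_int_eq_factorial_mul_leadingCoeff_hilbertPolynomial_subquot e h hQ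
  refine ⟨c, ?_, hc⟩
  have hpos : (0 : ℚ) < c := by
    rw [← hc]
    exact mul_pos (by positivity) (leadingCoeff_hilbertPolynomial_subquot_pos e hr hN hN' h hQ hQ0)
  exact_mod_cast hpos

/-! ### `dim Z ≤ dim X` and `dim Supp 𝓘 ≤ dim X` -/

/-- **`deg P_Z ≤ deg P_X` for closed subschemes `Z ⊆ X`** (graded `N ≤ N' ⊆ F_e`,
`X = (F_e ⧸ N)~`, `Z = (F_e ⧸ N')~`; `k` a field, `r ≥ 1`): `P_X = P_{N'⧸N} + P_Z` with both
summands zero or of positive leading coefficient, so no cancellation — `dim Z ≤ dim X` via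
`deg P = dim` (I Thm. 7.5). [cite: Hartshorne1977, I Thm. 7.5 (p. 51)]
[cite: Hartshorne1977, I Prop. 7.6 (b) (proof, p. 52)] -/
theorem natDegree_hilbertPolynomial_quot_mono (hr : 1 ≤ r) {N N' : Submodule (P k r) (J → P k r)}
    (hN : IsGraded e N) (hN' : IsGraded e N') (h : N ≤ N') {QX QZ : ℚ[X]}
    (hQX : ∀ n : ℤ, ((∑ q ∈ Finset.range (r + 1), (-1 : ℤ) ^ q *
      (Module.finrank k ((quot e N n).homology q) : ℤ) : ℤ) : ℚ) = QX.eval (n : ℚ))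
    (hQZ : ∀ n : ℤ, ((∑ q ∈ Finset.range (r + 1), (-1 : ℤ) ^ q *
      (Module.finrank k ((quot e N' n).homology q) : ℤ) : ℤ) : ℚ) = QZ.eval (n : ℚ)) :
    QZ.natDegree ≤ QX.natDegree := by
  obtain ⟨QI, hQI⟩ := exists_polynomial_eulerCharSubquot e N N' h hN hN'
  have hQI' : ∀ n : ℤ, ((∑ q ∈ Finset.range (r + 1), (-1 : ℤ) ^ q *
      (Module.finrank k ((subquot e N N' h n).homology q) : ℤ) : ℤ) : ℚ) = QI.eval (n : ℚ) :=
    fun n => by rw [← hQI n, eulerCharSubquot_def]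
  have hsum : QX = QI + QZ := by
    rw [hilbertPolynomial_subquot_eq_sub e hN hN' h hQI' hQX hQZ, sub_add_cancel]
  have hI : QI = 0 ∨ 0 < QI.leadingCoeff := by
    by_cases h0 : QI = 0
    · exact Or.inl h0
    · exact Or.inr (leadingCoeff_hilbertPolynomial_subquot_pos e hr hN hN' h hQI' h0)
  have hZ : QZ = 0 ∨ 0 < QZ.leadingCoeff := by
    by_cases h0 : QZ = 0
    · exact Or.inl h0
    · exact Or.inr (leadingCoeff_hilbertPolynomial_pos e hr hN' hQZ h0)
  rw [hsum, add_comm]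
  exact natDegree_le_natDegree_add hZ hI

/-- **`deg P_𝓘 ≤ deg P_X`** for the ideal sheaf `𝓘 = (N' ⧸ N)~ ⊆ 𝒪_X = (F_e ⧸ N)~`
(`dim Supp 𝓘 ≤ dim X`). [cite: Hartshorne1977, I Thm. 7.5 (p. 51)]
[cite: Hartshorne1977, I Prop. 7.6 (b) (proof, p. 52)] -/
theorem natDegree_hilbertPolynomial_subquot_le_quot (hr : 1 ≤ r)
    {N N' : Submodule (P k r) (J → P k r)} (hN : IsGraded e N) (hN' : IsGraded e N') (h : N ≤ N')
    {QX QI : ℚ[X]}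
    (hQX : ∀ n : ℤ, ((∑ q ∈ Finset.range (r + 1), (-1 : ℤ) ^ q *
      (Module.finrank k ((quot e N n).homology q) : ℤ) : ℤ) : ℚ) = QX.eval (n : ℚ))
    (hQI : ∀ n : ℤ, ((∑ q ∈ Finset.range (r + 1), (-1 : ℤ) ^ q *
      (Module.finrank k ((subquot e N N' h n).homology q) : ℤ) : ℤ) : ℚ) = QI.eval (n : ℚ)) :
    QI.natDegree ≤ QX.natDegree := by
  obtain ⟨QZ, hQZ⟩ := exists_polynomial_eulerChar_quot e hN'
  have hsum : QX = QI + QZ := by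
    rw [hilbertPolynomial_subquot_eq_sub e hN hN' h hQI hQX hQZ, sub_add_cancel]
  have hI : QI = 0 ∨ 0 < QI.leadingCoeff := by
    by_cases h0 : QI = 0
    · exact Or.inl h0
    · exact Or.inr (leadingCoeff_hilbertPolynomial_subquot_pos e hr hN hN' h hQI h0)
  have hZ : QZ = 0 ∨ 0 < QZ.leadingCoeff := by
    by_cases h0 : QZ = 0
    · exact Or.inl h0
    · exact Or.inr (leadingCoeff_hilbertPolynomial_pos e hr hN' hQZ h0)
  rw [hsum]
  exact natDegree_le_natDegree_add hI hZ

/-- **`lc(P_Z) ≤ lc(P_X)` when `Z ⊆ X` have Hilbert polynomials of the same degree**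
(`deg Z ≤ deg X` for `Z ⊆ X` of the same dimension). [cite: Hartshorne1977, I Prop. 7.6 (b) (proof, p. 52)] -/
theorem leadingCoeff_hilbertPolynomial_quot_mono (hr : 1 ≤ r) {N N' : Submodule (P k r) (J → P k r)}
    (hN : IsGraded e N) (hN' : IsGraded e N') (h : N ≤ N') {QX QZ : ℚ[X]}
    (hQX : ∀ n : ℤ, ((∑ q ∈ Finset.range (r + 1), (-1 : ℤ) ^ q *
      (Module.finrank k ((quot e N n).homology q) : ℤ) : ℤ) : ℚ) = QX.eval (n : ℚ))
    (hQZ : ∀ n : ℤ, ((∑ q ∈ Finset.range (r + 1), (-1 : ℤ) ^ q *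
      (Module.finrank k ((quot e N' n).homology q) : ℤ) : ℤ) : ℚ) = QZ.eval (n : ℚ))
    (hdeg : QZ.natDegree = QX.natDegree) : QZ.leadingCoeff ≤ QX.leadingCoeff := by
  obtain ⟨QI, hQI⟩ := exists_polynomial_eulerCharSubquot e N N' h hN hN'
  have hQI' : ∀ n : ℤ, ((∑ q ∈ Finset.range (r + 1), (-1 : ℤ) ^ q *
      (Module.finrank k ((subquot e N N' h n).homology q) : ℤ) : ℤ) : ℚ) = QI.eval (n : ℚ) :=
    fun n => by rw [← hQI n, eulerCharSubquot_def]
  have hsum : QX = QI + QZ := by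
    rw [hilbertPolynomial_subquot_eq_sub e hN hN' h hQI' hQX hQZ, sub_add_cancel]
  have hI : QI = 0 ∨ 0 < QI.leadingCoeff := by
    by_cases h0 : QI = 0
    · exact Or.inl h0
    · exact Or.inr (leadingCoeff_hilbertPolynomial_subquot_pos e hr hN hN' h hQI' h0)
  have hZ : QZ = 0 ∨ 0 < QZ.leadingCoeff := by
    by_cases h0 : QZ = 0
    · exact Or.inl h0
    · exact Or.inr (leadingCoeff_hilbertPolynomial_pos e hr hN' hQZ h0)
  subst hsum
  exact leadingCoeff_le_leadingCoeff_add hI hZ hdeg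

end LaurentCech

end Literature.Algebra.Homology

end
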